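import Summits.AtomisticToContinuum.Crystallization.Theorems.FreeSplittingCertificatesStrictSplittingRuleTorusModel442AllSites
import Summits.AtomisticToContinuum.Crystallization.Theorems.FreeSplittingCertificatesStrictSplittingRuleTorusModel442Real

/-!
# The joint (r6) sitewise LMI on the hcp torus 4×4×2 at every site, for REAL (ordered-field-valued) displacement fields

Route `FreeSplittingCertificates`, crux `StrictSplittingRule` (stmt-AtomisticToContinuum-12560); unit b2b-freesplit-B (block 2b,
PART B, gen 1).  **VALUE = theorem about a FINITE model — NOT summit progress**; `stub_coreJointCoercive` is not proved.

Combines `…TorusModel442AllSites.lean` (covariance checks, every site, rational fields) with `…TorusModel442Real.lean` (reference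
sites, fields with values in any linearly ordered field `R`, e.g. `ℝ`):
`jointLMI442_allSites_real : ∀ (p : Site) (u : Fin 192 → R), demandR p u + margin442 · normSqGR u ≤ supplyR p u + transferR p u + meanProjR u`
(+ the zero-mean form).  No new computation: the landed checks `covA_check`, `covB_check`, `cover_check`, `norm_perm_check`,
`sumF_perm_check` and certificates `certA_valid`, `certB_valid` are transported by generic lemmas over `R`. [folklore]
-/

namespace Summit.AtomisticToContinuum.Crystallization.Theorems.StrictSplittingRuleTorusLMI

open Literature.Computation.Certificates

variable {R : Type*} [Field R] [LinearOrder R] [IsStrictOrderedRing R]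

omit [LinearOrder R] [IsStrictOrderedRing R] in
/-- A relabelled functional at `u` is the functional at `u ∘ σ` (over `R`). [folklore] -/
theorem LinF.evalR_relabel (σ : Fin 192 → Fin 192) (ℓ : LinF 192) (u : Fin 192 → R) :
    LinF.evalR (LinF.relabel σ ℓ) u = LinF.evalR ℓ (u ∘ σ) := by
  induction ℓ with
  | nil => simp [LinF.relabel]
  | cons p t ih => simp only [LinF.relabel, List.map_cons, LinF.evalR_cons] at ih ⊢; rw [ih]; rfl

omit [LinearOrder R] [IsStrictOrderedRing R] in
/-- Relabelled term lists at `u` are the original lists at `u ∘ σ` (over `R`). [folklore] -/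
theorem evalQR_mapShift (σ : Fin 192 → Fin 192) (ts : List (Term 192)) (u : Fin 192 → R) :
    evalQR (ts.map (shiftTerm σ)) u = evalQR ts (u ∘ σ) := by
  induction ts with
  | nil => simp
  | cons t ts ih => simp only [List.map_cons, evalQR_cons, shiftTerm, LinF.evalR_relabel] at ih ⊢; rw [ih]

omit [LinearOrder R] [IsStrictOrderedRing R] in
/-- `evalQR` is invariant under permutation of the term list. [folklore] -/
theorem evalQR_perm {ts ts' : List (Term 192)} (h : ts.Perm ts') (u : Fin 192 → R) : evalQR ts u = evalQR ts' u := by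
  unfold evalQR; exact (h.map _).sum_eq

omit [LinearOrder R] [IsStrictOrderedRing R] in
/-- `LinF.evalR` is invariant under permutation of the entries. [folklore] -/
theorem LinF.evalR_perm {ℓ ℓ' : LinF 192} (h : ℓ.Perm ℓ') (u : Fin 192 → R) : LinF.evalR ℓ u = LinF.evalR ℓ' u := by
  unfold LinF.evalR; exact (h.map _).sum_eq

omit [LinearOrder R] [IsStrictOrderedRing R] in
/-- `‖u ∘ σ_g‖²_G = ‖u‖²_G` for a translation (over `R`). [folklore] -/
theorem normSqGR_shift {g : Off} (hg : g ∈ evenShifts) (u : Fin 192 → R) : normSqGR (u ∘ shiftIdx g) = normSqGR u := by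
  unfold normSqGR
  rw [← evalQR_mapShift, evalQR_perm (norm_perm_check g hg)]

omit [LinearOrder R] [IsStrictOrderedRing R] in
/-- `meanProjR (u ∘ σ_g) = meanProjR u` for a translation (over `R`). [folklore] -/
theorem meanProjR_shift {g : Off} (hg : g ∈ evenShifts) (u : Fin 192 → R) : meanProjR (u ∘ shiftIdx g) = meanProjR u := by
  have h : ∀ c : Fin 3, LinF.evalR (sumF c) (u ∘ shiftIdx g) = LinF.evalR (sumF c) u := fun c => by
    rw [← LinF.evalR_relabel, LinF.evalR_perm (sumF_perm_check g hg c)]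
  simp only [meanProjR, projTerms, sq, evalQR_cons, evalQR_nil, h]

omit [LinearOrder R] [IsStrictOrderedRing R] in
/-- The four forms at a translate are the reference forms at the translated field (over `R`). [folklore] -/
theorem formsR_shift {p r : Site} {g : Off}
    (hcov : siteTermLists p = (siteTermLists r).map fun ts => ts.map (shiftTerm (shiftIdx g))) (u : Fin 192 → R) :
    supplyR p u = supplyR r (u ∘ shiftIdx g) ∧ transferR p u = transferR r (u ∘ shiftIdx g) ∧
      demandR p u = demandR r (u ∘ shiftIdx g) := by
  simp only [siteTermLists, List.map_cons, List.map_nil, List.cons.injEq, and_true] at hcov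
  obtain ⟨h1, h2, h3, h4⟩ := hcov
  refine ⟨?_, ?_, ?_⟩
  · unfold supplyR; rw [h1, evalQR_mapShift]
  · unfold transferR; rw [h2, evalQR_mapShift]
  · unfold demandR; rw [h3, h4, evalQR_mapShift, evalQR_mapShift]

/-- **The joint (r6) sitewise LMI at EVERY site of the 4×4×2 hcp torus for `R`-valued (e.g. real) displacement fields**
(margin `m = 39101/2²⁰`): `D_p(u) + m‖u‖²_G ≤ S_p(u) + T_p(u) + meanProj(u)`.  Finite model of H12⋆; not the stub. -/
theorem jointLMI442_allSites_real (p : Site) (u : Fin 192 → R) :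
    demandR p u + (margin442 : R) * normSqGR u ≤ supplyR p u + transferR p u + meanProjR u := by
  obtain ⟨g, hg, hp⟩ := cover_check p
  cases hpar : parity p
  · rw [hpar] at hp; simp only [Bool.false_eq_true, ↓reduceIte] at hp
    have hcov := covB_check g hg
    rw [← hp] at hcov
    obtain ⟨hs, ht, hd⟩ := formsR_shift hcov u
    have h := jointLMI442B_real (u ∘ shiftIdx g)
    rw [normSqGR_shift hg, meanProjR_shift hg, ← hs, ← ht, ← hd] at h
    exact h
  · rw [hpar] at hp; simp only [↓reduceIte] at hp
    have hcov := covA_check g hg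
    rw [← hp] at hcov
    obtain ⟨hs, ht, hd⟩ := formsR_shift hcov u
    have h := jointLMI442A_real (u ∘ shiftIdx g)
    rw [normSqGR_shift hg, meanProjR_shift hg, ← hs, ← ht, ← hd] at h
    exact h

/-- **Zero-mean form at every site, `R`-valued fields.** -/
theorem jointLMI442_allSites_real_zeroMean (p : Site) (u : Fin 192 → R) (h0 : ∀ c : Fin 3, (sumF c).evalR u = 0) :
    demandR p u + (margin442 : R) * normSqGR u ≤ supplyR p u + transferR p u := by
  have h := jointLMI442_allSites_real p u
  rw [meanProjR_eq_zero h0, add_zero] at h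
  exact h

end Summit.AtomisticToContinuum.Crystallization.Theorems.StrictSplittingRuleTorusLMI
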